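import Mathlib
import Summits.AtomisticToContinuum.HydrodynamicLimit.Theses.JParityClosure
import HarnessLib

/-!
# JParityClosure / ParityInBand — helper: a global `C²`/Gibbs/stable extension of a low-density
# equation of state off the packing band

Step (iv) of `Summit.AtomisticToContinuum.HydrodynamicLimit.Theses.JParityClosure.ParityInBand`
(and every BF18-based closure of the hard-sphere hydrodynamic limit) runs
`Literature.Analysis.FluidPDE.CompressibleEuler.brezinaFeireisl2018_thm_3_3`, whose equation-of-state
hypotheses are GLOBAL on the open quadrant, for the hard-sphere law, whose excess free energy
`F = hsExcessFreeEnergy` is only known to be smooth on the packing band `[0, η₀)`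
(`HsEosLowDensity`). Since `DensityCap` keeps every state in the band, it is legitimate to modify
the law off the band. This file constructs the modification: from a `C³` germ `F` near `0` it
produces `χ̃, F̃ : ℝ → ℝ`, `C²` on `(0,∞)`, with the virial relation `χ̃ η = 1 + η F̃'(η)`, the
stability `(η χ̃)' > 0`, `χ̃` bounded, and `F̃ = F`, `χ̃ = 1 + η F'` on `(0, η₁]` — exactly the inputs of
`monatomicExcess_bf_hypotheses` (JParityClosureParityInBandEos.lean). Construction: interpolate the
DERIVATIVE of the reduced pressure `V = η + η² F'` between `V'` (near `0`, where `V' > 0` by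
continuity from `V'(0) = 1`) and the constant `1` with a smooth transition (a convex combination of
positive functions is positive), and integrate back.
-/

namespace Summit.AtomisticToContinuum.HydrodynamicLimit.Theorems

open Set MeasureTheory intervalIntegral

/-- **Primitives of `Cⁿ` functions on an open convex set are `Cⁿ⁺¹`.** For `g` of class `Cⁿ` on an
open convex `U ⊆ ℝ` and a base point `a ∈ U`, the primitive `x ↦ ∫ r in a..x, g r` has derivative
`g x` at every `x ∈ U` and is of class `Cⁿ⁺¹` on `U` (fundamental theorem of calculus). [folklore] -/
theorem hasDerivAt_primitive_of_contDiffOn {g : ℝ → ℝ} {U : Set ℝ} {a : ℝ} {n : ℕ}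
    (hU : IsOpen U) (hUc : Convex ℝ U) (ha : a ∈ U) (hg : ContDiffOn ℝ n g U) :
    (∀ x ∈ U, HasDerivAt (fun y => ∫ r in a..y, g r) (g x) x) ∧
      ContDiffOn ℝ (n + 1) (fun y => ∫ r in a..y, g r) U := by
  have hgc : ContinuousOn g U := hg.continuousOn
  have hderiv : ∀ x ∈ U, HasDerivAt (fun y => ∫ r in a..y, g r) (g x) x := by
    intro x hx
    have hsub : uIcc a x ⊆ U := hUc.ordConnected.uIcc_subset ha hx
    refine integral_hasDerivAt_right ((hgc.mono hsub).intervalIntegrable) ?_ ?_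
    · exact hgc.stronglyMeasurableAtFilter hU _ hx
    · exact hgc.continuousAt (hU.mem_nhds hx)
  refine ⟨hderiv, ?_⟩
  rw [contDiffOn_succ_iff_deriv_of_isOpen hU]
  refine ⟨fun x hx => (hderiv x hx).differentiableAt.differentiableWithinAt, ?_, ?_⟩
  · intro h
    exact absurd h (by norm_cast)
  · exact hg.congr fun x hx => (hderiv x hx).deriv


/-- The smooth transition cut-off at scale `η₁ > 0`: `ψ η = smoothTransition ((2η₁ - η)/η₁)` is
smooth, takes values in `[0,1]`, equals `1` on `(-∞, η₁]` and `0` on `[2η₁, ∞)`. [folklore] -/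
theorem smoothCutoff_props {η₁ : ℝ} (hη₁ : 0 < η₁) :
    ContDiff ℝ 2 (fun η : ℝ => Real.smoothTransition ((2 * η₁ - η) / η₁)) ∧
    (∀ η, 0 ≤ Real.smoothTransition ((2 * η₁ - η) / η₁)) ∧
    (∀ η, Real.smoothTransition ((2 * η₁ - η) / η₁) ≤ 1) ∧
    (∀ η, η ≤ η₁ → Real.smoothTransition ((2 * η₁ - η) / η₁) = 1) ∧
    (∀ η, 2 * η₁ ≤ η → Real.smoothTransition ((2 * η₁ - η) / η₁) = 0) := by
  refine ⟨?_, fun η => Real.smoothTransition.nonneg _, fun η => Real.smoothTransition.le_one _,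
    fun η hη => Real.smoothTransition.one_of_one_le ?_,
    fun η hη => Real.smoothTransition.zero_of_nonpos ?_⟩
  · exact Real.smoothTransition.contDiff.comp ((contDiff_const.sub contDiff_id).div_const _)
  · rw [le_div_iff₀ hη₁]; linarith
  · exact div_nonpos_of_nonpos_of_nonneg (by linarith) hη₁.le

/-- **Global virial extension of a low-density free energy.** Let `F` be `C³` on `(-η₀, η₀)`
(e.g. the analytic germ of `hsExcessFreeEnergy` from `HsEosLowDensity`). Then there are
`0 < η₁` with `2η₁ < η₀` and functions `χ̃, F̃ : ℝ → ℝ`, both `C²` on `(0, ∞)`, such that: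
the virial relation `χ̃ η = 1 + η F̃'(η)` holds on `(0,∞)` (so `EulerEOS.monatomicExcess` built from
them satisfies Gibbs' relation), the reduced pressure is strictly increasing,
`(η χ̃)' = χ̃ + η χ̃' > 0` on `(0,∞)` (thermodynamic stability), `χ̃` is bounded on `(0,∞)` (pressure
growth), and on the band `(0, η₁]` nothing was changed: `F̃ = F` and `χ̃ η = 1 + η F'(η)`.
Construction: with `V = η + η² F'` (so `V' = 1 + 2ηF' + η²F''`, `V'(0) = 1`), put
`g = ψ V' + (1 - ψ)` for the smooth cut-off `ψ` at a scale `η₁` below which `V' > 1/2`; then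
`g ≥ 1/2`, `Ṽ = ∫₀ g`, `χ̃ = Ṽ/η`, `F̃ = F(η₁) + ∫_{η₁} (χ̃ - 1)/r dr`. [folklore] -/
theorem exists_global_virial_extension {F : ℝ → ℝ} {η₀ : ℝ} (hη₀ : 0 < η₀)
    (hF : ContDiffOn ℝ 3 F (Ioo (-η₀) η₀)) :
    ∃ η₁ : ℝ, 0 < η₁ ∧ 2 * η₁ < η₀ ∧ ∃ χt Ft : ℝ → ℝ,
      ContDiffOn ℝ 2 χt (Ioi 0) ∧ ContDiffOn ℝ 2 Ft (Ioi 0) ∧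
      (∀ η, 0 < η → χt η = 1 + η * deriv Ft η) ∧
      (∀ η, 0 < η → 0 < χt η + η * deriv χt η) ∧
      (∃ B : ℝ, ∀ η, 0 < η → |χt η| ≤ B) ∧
      (∀ η ∈ Ioc 0 η₁, Ft η = F η) ∧
      (∀ η ∈ Ioc 0 η₁, χt η = 1 + η * deriv F η) := by
  -- the germ and its derivatives on `U₀ = (-η₀, η₀)`
  set U₀ : Set ℝ := Ioo (-η₀) η₀ with hU₀
  have hU₀o : IsOpen U₀ := isOpen_Ioo
  have h0U₀ : (0 : ℝ) ∈ U₀ := ⟨by linarith, hη₀⟩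
  set F1 : ℝ → ℝ := deriv F with hF1
  set F2 : ℝ → ℝ := deriv F1 with hF2
  have hF1c : ContDiffOn ℝ 2 F1 U₀ := hF.deriv_of_isOpen hU₀o (by norm_num)
  have hF2c : ContDiffOn ℝ 1 F2 U₀ := hF1c.deriv_of_isOpen hU₀o (by norm_num)
  have hFd : ∀ x ∈ U₀, HasDerivAt F (F1 x) x := fun x hx =>
    ((hF.differentiableOn (by norm_num)).differentiableAt (hU₀o.mem_nhds hx)).hasDerivAt
  have hF1d : ∀ x ∈ U₀, HasDerivAt F1 (F2 x) x := fun x hx =>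
    ((hF1c.differentiableOn (by norm_num)).differentiableAt (hU₀o.mem_nhds hx)).hasDerivAt
  -- `W = V'` where `V = η + η² F'`
  set W : ℝ → ℝ := fun η => 1 + 2 * η * F1 η + η ^ 2 * F2 η with hW
  have hWc : ContDiffOn ℝ 1 W U₀ := by
    refine (contDiffOn_const.add ((contDiffOn_const.mul contDiffOn_id).mul
      (hF1c.of_le (by norm_num)))).add ((contDiffOn_id.pow 2).mul hF2c)
  have hW0 : W 0 = 1 := by simp [hW]
  -- a scale below which `W > 1/2`
  obtain ⟨ε, hε, hεW⟩ : ∃ ε > 0, ∀ η, |η| < ε → 1 / 2 < W η := by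
    have hca : ContinuousAt W 0 := hWc.continuousOn.continuousAt (hU₀o.mem_nhds h0U₀)
    have hev : ∀ᶠ η in nhds (0 : ℝ), 1 / 2 < W η :=
      hca.eventually (lt_mem_nhds (by rw [hW0]; norm_num))
    obtain ⟨ε, hε, h⟩ := Metric.eventually_nhds_iff.1 hev
    exact ⟨ε, hε, fun η hη => h (by simpa [Real.dist_eq] using hη)⟩
  set η₁ : ℝ := min (ε / 3) (η₀ / 3) with hη₁
  have hη₁pos : 0 < η₁ := lt_min (by linarith) (by linarith)
  have hη₁ε : 2 * η₁ < ε := by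
    have : η₁ ≤ ε / 3 := min_le_left _ _
    linarith
  have hη₁η₀ : 2 * η₁ < η₀ := by
    have : η₁ ≤ η₀ / 3 := min_le_right _ _
    linarith
  -- the cut-off
  obtain ⟨hψc, hψ0, hψ1, hψone, hψzero⟩ := smoothCutoff_props hη₁pos
  -- `g = ψ W + (1 - ψ)`, the interpolated `V'`
  set g : ℝ → ℝ := fun η => Real.smoothTransition ((2 * η₁ - η) / η₁) * W η +
    (1 - Real.smoothTransition ((2 * η₁ - η) / η₁)) with hg
  set U : Set ℝ := Ioi (-η₀) with hU
  have hUo : IsOpen U := isOpen_Ioi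
  have hUc : Convex ℝ U := convex_Ioi _
  have h0U : (0 : ℝ) ∈ U := by simp [hU, hη₀]
  have hgc : ContDiffOn ℝ 1 g U := by
    refine contDiffOn_of_locally_contDiffOn fun x hx => ?_
    by_cases hxη : x < η₀
    · refine ⟨U₀, hU₀o, ⟨hx, hxη⟩, ?_⟩
      have hWc' : ContDiffOn ℝ 1 W (U ∩ U₀) := hWc.mono inter_subset_right
      have hψc' : ContDiffOn ℝ 1 (fun η : ℝ => Real.smoothTransition ((2 * η₁ - η) / η₁))
          (U ∩ U₀) := (hψc.of_le (by norm_num)).contDiffOn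
      exact (hψc'.mul hWc').add (contDiffOn_const.sub hψc')
    · refine ⟨Ioi (2 * η₁), isOpen_Ioi, ?_, ?_⟩
      · simp only [mem_Ioi]; linarith
      · have : EqOn g (fun _ => (1 : ℝ)) (U ∩ Ioi (2 * η₁)) := fun y hy => by
          simp only [hg]
          rw [hψzero y (le_of_lt hy.2)]
          ring
        exact contDiffOn_const.congr this
  have hg_lower : ∀ η, 0 ≤ η → 1 / 2 ≤ g η := by
    intro η hη
    by_cases h2 : η < 2 * η₁
    · have hWη : 1 / 2 < W η := hεW η (by rw [abs_of_nonneg hη]; linarith)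
      have := hψ0 η
      have := hψ1 η
      simp only [hg]
      nlinarith
    · simp only [hg]
      rw [hψzero η (not_lt.1 h2)]
      norm_num
  have hg_one : ∀ η, 2 * η₁ ≤ η → g η = 1 := fun η hη => by
    simp only [hg]; rw [hψzero η hη]; ring
  have hg_W : ∀ η, η ≤ η₁ → g η = W η := fun η hη => by
    simp only [hg]; rw [hψone η hη]; ring
  -- `V = ∫₀ g`
  obtain ⟨hVd, hVc⟩ := hasDerivAt_primitive_of_contDiffOn hUo hUc h0U hgc
  set V : ℝ → ℝ := fun y => ∫ r in (0 : ℝ)..y, g r with hV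
  -- `χ̃ = V / η`
  set χt : ℝ → ℝ := fun η => V η / η with hχt
  have hposU : Ioi (0 : ℝ) ⊆ U := fun x hx => lt_trans (by linarith) (mem_Ioi.1 hx)
  have hχtc : ContDiffOn ℝ 2 χt (Ioi 0) :=
    (hVc.mono hposU).div contDiffOn_id fun x hx => ne_of_gt hx
  have hχtd : ∀ η, 0 < η → HasDerivAt χt ((g η * η - V η * 1) / η ^ 2) η := fun η hη =>
    (hVd η (hposU hη)).div (hasDerivAt_id η) (ne_of_gt hη)
  have hstab : ∀ η, 0 < η → χt η + η * deriv χt η = g η := by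
    intro η hη
    have hne : η ≠ 0 := ne_of_gt hη
    rw [(hχtd η hη).deriv]
    simp only [hχt]
    field_simp
    ring
  -- `F̃ = F η₁ + ∫_{η₁} (χ̃ - 1)/r`
  set h : ℝ → ℝ := fun r => (χt r - 1) / r with hh
  have hhc : ContDiffOn ℝ 2 h (Ioi 0) :=
    (hχtc.sub contDiffOn_const).div contDiffOn_id fun x hx => ne_of_gt hx
  have hη₁U : η₁ ∈ Ioi (0 : ℝ) := hη₁pos
  obtain ⟨hFtd, hFtc⟩ := hasDerivAt_primitive_of_contDiffOn isOpen_Ioi (convex_Ioi _) hη₁U hhc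
  set Ft : ℝ → ℝ := fun η => F η₁ + ∫ r in η₁..η, h r with hFt
  have hFtd' : ∀ η, 0 < η → HasDerivAt Ft (h η) η := fun η hη =>
    ((hFtd η hη).const_add (F η₁))
  refine ⟨η₁, hη₁pos, hη₁η₀, χt, Ft, hχtc, ?_, ?_, ?_, ?_, ?_, ?_⟩
  · -- `F̃ ∈ C²`
    exact (contDiffOn_const.add hFtc).of_le (by norm_num)
  · -- virial relation
    intro η hη
    have hne : η ≠ 0 := ne_of_gt hη
    rw [(hFtd' η hη).deriv]
    simp only [hh]
    field_simp
    ring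
  · -- stability
    intro η hη
    rw [hstab η hη]
    linarith [hg_lower η hη.le]
  · -- boundedness of `χ̃`
    obtain ⟨M, hM⟩ : ∃ M, ∀ x ∈ Icc (0 : ℝ) (2 * η₁), ‖g x‖ ≤ M :=
      isCompact_Icc.exists_bound_of_continuousOn
        (hgc.continuousOn.mono fun x hx => lt_of_lt_of_le (by linarith) hx.1)
    have hgi : ∀ a b, 0 ≤ a → 0 ≤ b → IntervalIntegrable g volume a b := fun a b ha hb =>
      (hgc.continuousOn.mono (hUc.ordConnected.uIcc_subset (hposU.trans subset_rfl |> fun h' =>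
        show a ∈ U from lt_of_lt_of_le (by linarith) ha) (lt_of_lt_of_le (by linarith) hb))).intervalIntegrable
    refine ⟨max M (|V (2 * η₁) - 2 * η₁| / (2 * η₁) + 1), fun η hη => ?_⟩
    by_cases h2 : η ≤ 2 * η₁
    · -- small `η`: `|V η| ≤ M η`
      have hVle : |V η| ≤ M * η := by
        have hb : ∀ x ∈ Set.uIoc (0:ℝ) η, ‖g x‖ ≤ M := by
          intro x hx
          rw [uIoc_of_le hη.le] at hx
          exact hM x ⟨hx.1.le, hx.2.trans h2⟩
        have := intervalIntegral.norm_integral_le_of_norm_le_const hb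
        simpa [hV, abs_of_pos hη] using this
      calc |χt η| = |V η| / η := by simp only [hχt, abs_div, abs_of_pos hη]
        _ ≤ M := by rw [div_le_iff₀ hη]; exact hVle
        _ ≤ _ := le_max_left _ _
    · -- large `η`: `V η = V (2η₁) + (η - 2η₁)`
      rw [not_le] at h2
      have hadd : V η = V (2 * η₁) + (η - 2 * η₁) := by
        have h1 : (∫ r in (0:ℝ)..(2 * η₁), g r) + ∫ r in (2 * η₁)..η, g r = ∫ r in (0:ℝ)..η, g r :=
          intervalIntegral.integral_add_adjacent_intervals (hgi _ _ le_rfl (by linarith))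
            (hgi _ _ (by linarith) hη.le)
        have h2' : ∫ r in (2 * η₁)..η, g r = η - 2 * η₁ := by
          rw [intervalIntegral.integral_congr (g := fun _ => (1 : ℝ)) fun x hx => ?_]
          · simp
          · exact hg_one x (by rw [uIcc_of_le h2.le] at hx; exact hx.1)
        simp only [hV]
        linarith
      have hηpos : 0 < 2 * η₁ := by linarith
      have key : χt η = (V (2 * η₁) - 2 * η₁) / η + 1 := by
        simp only [hχt]
        rw [hadd]
        field_simp
        ring
      rw [key]
      calc |(V (2 * η₁) - 2 * η₁) / η + 1| ≤ |(V (2 * η₁) - 2 * η₁) / η| + |(1:ℝ)| :=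
            abs_add_le _ _
        _ = |V (2 * η₁) - 2 * η₁| / η + 1 := by rw [abs_div, abs_of_pos hη, abs_one]
        _ ≤ |V (2 * η₁) - 2 * η₁| / (2 * η₁) + 1 := by
          have := div_le_div_of_nonneg_left (abs_nonneg (V (2 * η₁) - 2 * η₁)) hηpos h2.le
          linarith
        _ ≤ _ := le_max_right _ _
  · -- `F̃ = F` on the band
    intro η hη
    have hsub : uIcc η₁ η ⊆ Ioc 0 η₁ := by
      rw [uIcc_of_ge hη.2]; exact fun x hx => ⟨lt_of_lt_of_le hη.1 hx.1, hx.2⟩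
    have hsubU₀ : Ioc 0 η₁ ⊆ U₀ := fun x hx => ⟨by linarith [hx.1], by linarith [hx.2]⟩
    -- on `(0, η₁]`, `χ̃ = 1 + η F'`, so `h = F'`
    have hχband : ∀ x ∈ Ioc 0 η₁, χt x = 1 + x * F1 x := by
      intro x hx
      have hVx : V x = x + x ^ 2 * F1 x := by
        have e1 : ∫ r in (0:ℝ)..x, g r = ∫ r in (0:ℝ)..x, W r :=
          intervalIntegral.integral_congr fun r hr => hg_W r (by
            rw [uIcc_of_le hx.1.le] at hr; exact hr.2.trans hx.2)
        have e2 : ∫ r in (0:ℝ)..x, W r = (x + x ^ 2 * F1 x) - (0 + 0 ^ 2 * F1 0) := by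
          apply intervalIntegral.integral_eq_sub_of_hasDerivAt
          · intro r hr
            rw [uIcc_of_le hx.1.le] at hr
            have hrU : r ∈ U₀ := ⟨by linarith [hr.1], by linarith [hr.2, hx.2]⟩
            refine ((hasDerivAt_id r).add (((hasDerivAt_id r).pow 2).mul (hF1d r hrU))).congr_deriv ?_
            simp only [hW, id]
            norm_num
            ring
          · exact ((hWc.continuousOn.mono fun r hr => by
              rw [uIcc_of_le hx.1.le] at hr
              exact ⟨by linarith [hr.1], by linarith [hr.2, hx.2]⟩)).intervalIntegrable
        simp only [hV]; rw [e1, e2]; ring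
      have hxne : x ≠ 0 := ne_of_gt hx.1
      simp only [hχt]; rw [hVx]; field_simp
    have e1 : ∫ r in η₁..η, h r = ∫ r in η₁..η, F1 r :=
      intervalIntegral.integral_congr fun r hr => by
        have hr' := hsub hr
        have hrne : r ≠ 0 := ne_of_gt hr'.1
        simp only [hh, hχband r hr']
        field_simp
        ring
    have e2 : ∫ r in η₁..η, F1 r = F η - F η₁ :=
      intervalIntegral.integral_eq_sub_of_hasDerivAt (fun r hr => hFd r (hsubU₀ (hsub hr)))
        ((hF1c.continuousOn.mono ((hsub.trans hsubU₀))).intervalIntegrable)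
    simp only [hFt]; rw [e1, e2]; ring
  · -- `χ̃ = 1 + η F'` on the band
    intro η hη
    have hVx : V η = η + η ^ 2 * F1 η := by
      have e1 : ∫ r in (0:ℝ)..η, g r = ∫ r in (0:ℝ)..η, W r :=
        intervalIntegral.integral_congr fun r hr => hg_W r (by
          rw [uIcc_of_le hη.1.le] at hr; exact hr.2.trans hη.2)
      have e2 : ∫ r in (0:ℝ)..η, W r = (η + η ^ 2 * F1 η) - (0 + 0 ^ 2 * F1 0) := by
        apply intervalIntegral.integral_eq_sub_of_hasDerivAt
        · intro r hr
          rw [uIcc_of_le hη.1.le] at hr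
          have hrU : r ∈ U₀ := ⟨by linarith [hr.1], by linarith [hr.2, hη.2]⟩
          refine ((hasDerivAt_id r).add (((hasDerivAt_id r).pow 2).mul (hF1d r hrU))).congr_deriv ?_
          simp only [hW, id]
          norm_num
          ring
        · exact ((hWc.continuousOn.mono fun r hr => by
            rw [uIcc_of_le hη.1.le] at hr
            exact ⟨by linarith [hr.1], by linarith [hr.2, hη.2]⟩)).intervalIntegrable
      simp only [hV]; rw [e1, e2]; ring
    have hne : η ≠ 0 := ne_of_gt hη.1
    simp only [hχt]; rw [hVx]; field_simp


open Literature.MathematicalPhysics.KineticTheory in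
/-- **The hard-sphere law, globally extended off the packing band.** Under `HsEosLowDensity`
(the hard-sphere excess free energy is real-analytic on a neighbourhood of `[0, η₀)`), for every
reduced diameter `σ > 0` there are a band edge `η₁ > 0` and functions `χ, f : ℝ → ℝ`, `C²` on
`(0,∞)`, satisfying the virial relation `χ ρ = 1 + ρ f'(ρ)`, the stability `(ρχ)' > 0`, `χ`
bounded — i.e. all inputs of `monatomicExcess_bf_hypotheses` — and AGREEING WITH THE HARD-SPHERE
LAW IN THE BAND: `f ρ = hsExcessFreeEnergy (ρσ³)` and `χ ρ = hsCompressibility (ρσ³)` whenever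
`0 < ρ`, `ρσ³ ≤ η₁`. Hence `EulerEOS.monatomicExcess χ f` is a global `C²`/Gibbs/stable equation of
state whose pressure is `hsPressure σ` and whose internal energy is `3ϑ/2` on the band states —
the equation of state with which step (iv) of `ParityInBand` runs BF18 (`DensityCap` keeps every
empirical and classical state in the band). [folklore] -/
theorem exists_hsEos_band_extension
    (h : Summit.AtomisticToContinuum.HydrodynamicLimit.Theses.JParityClosure.HsEosLowDensity)
    {σ : ℝ} (hσ : 0 < σ) :
    ∃ η₁ : ℝ, 0 < η₁ ∧ ∃ χ f : ℝ → ℝ,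
      ContDiffOn ℝ 2 χ (Ioi 0) ∧ ContDiffOn ℝ 2 f (Ioi 0) ∧
      (∀ ρ, 0 < ρ → χ ρ = 1 + ρ * deriv f ρ) ∧
      (∀ ρ, 0 < ρ → 0 < χ ρ + ρ * deriv χ ρ) ∧
      (∃ B : ℝ, ∀ ρ, 0 < ρ → |χ ρ| ≤ B) ∧
      (∀ ρ, 0 < ρ → ρ * σ ^ 3 ≤ η₁ →
        f ρ = hsExcessFreeEnergy (ρ * σ ^ 3) ∧ χ ρ = hsCompressibility (ρ * σ ^ 3)) := by
  obtain ⟨η₀, hη₀, F, hFa, hFeq, -, -, -⟩ := h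
  have hF3 : ContDiffOn ℝ 3 F (Ioo (-η₀) η₀) := hFa.contDiffOn isOpen_Ioo.uniqueDiffOn
  obtain ⟨η₁, hη₁, hη₁η₀, χt, Ft, hχtc, hFtc, hvir, hstab, ⟨B, hB⟩, hFband, hχband⟩ :=
    exists_global_virial_extension hη₀ hF3
  have hσ3 : 0 < σ ^ 3 := by positivity
  -- the scaling `ρ ↦ ρ σ³`
  have hmaps : MapsTo (fun ρ : ℝ => ρ * σ ^ 3) (Ioi 0) (Ioi 0) := fun ρ hρ => mul_pos hρ hσ3
  have hsc : ContDiff ℝ 2 (fun ρ : ℝ => ρ * σ ^ 3) := contDiff_id.mul contDiff_const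
  have hFtd : ∀ η, 0 < η → HasDerivAt Ft (deriv Ft η) η := fun η hη =>
    ((hFtc.differentiableOn (by norm_num)).differentiableAt (isOpen_Ioi.mem_nhds hη)).hasDerivAt
  have hχtd : ∀ η, 0 < η → HasDerivAt χt (deriv χt η) η := fun η hη =>
    ((hχtc.differentiableOn (by norm_num)).differentiableAt (isOpen_Ioi.mem_nhds hη)).hasDerivAt
  have hdf : ∀ ρ, 0 < ρ → deriv (fun r => Ft (r * σ ^ 3)) ρ = deriv Ft (ρ * σ ^ 3) * σ ^ 3 :=
    fun ρ hρ => ((hFtd _ (mul_pos hρ hσ3)).comp ρ (hasDerivAt_mul_const (σ ^ 3))).deriv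
  have hdχ : ∀ ρ, 0 < ρ → deriv (fun r => χt (r * σ ^ 3)) ρ = deriv χt (ρ * σ ^ 3) * σ ^ 3 :=
    fun ρ hρ => ((hχtd _ (mul_pos hρ hσ3)).comp ρ (hasDerivAt_mul_const (σ ^ 3))).deriv
  refine ⟨η₁, hη₁, fun ρ => χt (ρ * σ ^ 3), fun ρ => Ft (ρ * σ ^ 3),
    hχtc.comp hsc.contDiffOn hmaps, hFtc.comp hsc.contDiffOn hmaps, ?_, ?_, ⟨B, fun ρ hρ =>
      hB _ (mul_pos hρ hσ3)⟩, ?_⟩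
  · intro ρ hρ
    beta_reduce
    rw [hdf ρ hρ, hvir _ (mul_pos hρ hσ3)]
    ring
  · intro ρ hρ
    beta_reduce
    rw [hdχ ρ hρ]
    have := hstab _ (mul_pos hρ hσ3)
    nlinarith [this]
  · intro ρ hρ hband
    have hη : ρ * σ ^ 3 ∈ Ioc 0 η₁ := ⟨mul_pos hρ hσ3, hband⟩
    have hηU : ρ * σ ^ 3 ∈ Ioo (-η₀) η₀ := ⟨by linarith [hη.1], by linarith [hη.2]⟩
    have hev : hsExcessFreeEnergy =ᶠ[nhds (ρ * σ ^ 3)] F := by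
      have hIoo : Ioo (0 : ℝ) η₀ ∈ nhds (ρ * σ ^ 3) :=
        isOpen_Ioo.mem_nhds ⟨hη.1, hηU.2⟩
      exact Filter.eventually_of_mem hIoo fun x hx => hFeq ⟨hx.1.le, hx.2⟩
    refine ⟨?_, ?_⟩
    · beta_reduce
      rw [hFband _ hη]
      exact (hFeq ⟨hη.1.le, hηU.2⟩).symm
    · beta_reduce
      rw [hχband _ hη, hsCompressibility, hev.deriv_eq]

end Summit.AtomisticToContinuum.HydrodynamicLimit.Theorems
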